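import Literature.Geometry.DiscreteGeometry.BondGraph
import Summits.AtomisticToContinuum.Crystallization.Theorems.OverbindingBudgetAffineCompressedCutOp

/-!
# NODE g79 «CompressedCut», toward the open leaf NS♭₂ — THE COVERING CONSTANT 1/√2 OF THE TWO-SHELL PATTERNS (seventh brick; first input of chains-exist)

Route `OverbindingBudget` (Crystallization), crux `RobustDefectLimitWindows` (stmt-AtomisticToContinuum-31280), decomp-a2c lens 4, generation 79, ADDENDUM 10.
Step (i) of the remaining g80 plan (memo NODE-g79 §5): registered first-shell CHAINS from the deep site to every site of the `r₁·nn` core EXIST.  Its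
geometric input is the COVERING PROPERTY of the first shell of both two-shell patterns: every direction is within `45°` of a first-shell vector,

* ★ `exists_firstShell_inner_ge`: for `P ∈ {fcc, hcp}` (two-shell, model coordinates) and every `u`, some FIRST-SHELL `w ∈ P` (`‖w‖ = 1`) has
  `‖u‖ ≤ √2·⟪w, u⟫` — the constant `1/√2` is sharp for both patterns (direction `(1,0,0)`);

proved through the integer models (`fccModelInt`, `hcpModelInt`): §1 four elementary quadratic inequalities; §2 the SORTED core `cover_sorted` (`|u₁| ≤ |u₀|`,
`|u₂| ≤ |u₁|`: an explicit model vector per sign pattern — cuboctahedron `(±3, ±3, 0)`; anticuboctahedron: cap `(3,3,0)`, basal `(±3, ∓3, 0)`, lower cap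
`(−4,−1,−1)` or basal `(−3, 0, 3)` according to `u₁² ≶ 2|u₀|u₂`); §3 coordinate permutations of the models (`decide`) and the unsorted statement; §4 the
pattern form; §5 ★ the DESCENT STEP `descent_step`: at a framed registered site, toward any target at distance `d ≥ 2·nn`, some first-shell pattern point
registers to a SITE closer to the target by `0.45·nn` (the chain induction over the core is left to g80, memo §5).

Deps: tree only (`…CompressedCutOp` for `norm_eq_one_of_sqNormInt`; the integer models of `Literature.Geometry.DiscreteGeometry.TwoShellIntegerModel`;
`Literature.Geometry.DiscreteGeometry.BondGraph` for `nearestDist`).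
No `instance`, no `notation`, no `set_option`, no new axioms, 0 sorry.
-/

namespace Summit.AtomisticToContinuum.Crystallization.Theorems.OverbindingBudgetAffineCompressedCutReach

open Literature.Geometry.DiscreteGeometry (sqNormInt intVec fccTwoShellPattern hcpTwoShellPattern fccModelInt hcpModelInt
  fccTwoShellPattern_eq_image hcpTwoShellPattern_eq_image nearestDist nearestDist_nonneg)

variable {N : ℕ}
open Summit.AtomisticToContinuum.Crystallization.Theorems.OverbindingBudgetAffineCompressedCutOp (norm_eq_one_of_sqNormInt)

/-! ## §1  Four quadratic inequalities -/

/-- `9(x² + y² + z²) ≤ (3x + 3y)²` when `0 ≤ z ≤ x, y`. [this file] -/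
theorem nine_sq_le_pair {x y z : ℝ} (hz : 0 ≤ z) (hzx : z ≤ x) (hzy : z ≤ y) :
    9 * (x ^ 2 + y ^ 2 + z ^ 2) ≤ (3 * x + 3 * y) ^ 2 := by
  nlinarith [mul_le_mul hzx hzy hz (hz.trans hzx)]

/-- `9(x² + y² + z²) ≤ (4x + y + z)²` when `0 ≤ z ≤ y ≤ x`. [this file] -/
theorem nine_sq_le_cap {x y z : ℝ} (hz : 0 ≤ z) (hzy : z ≤ y) (hyx : y ≤ x) :
    9 * (x ^ 2 + y ^ 2 + z ^ 2) ≤ (4 * x + y + z) ^ 2 := by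
  nlinarith [mul_le_mul_of_nonneg_left hyx (hz.trans hzy), mul_le_mul_of_nonneg_left (hzy.trans hyx) hz]

/-- `9(x² + y² + z²) ≤ (3x + 3z)²` when `y² ≤ 2xz`. [this file] -/
theorem nine_sq_le_skew {x y z : ℝ} (h : y ^ 2 ≤ 2 * x * z) :
    9 * (x ^ 2 + y ^ 2 + z ^ 2) ≤ (3 * x + 3 * z) ^ 2 := by
  nlinarith

/-- `9(x² + y² + z²) ≤ (4x + y − z)²` and `0 ≤ 4x + y − z` when `2xz ≤ y²`, `0 ≤ z ≤ y ≤ x`. [this file] -/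
theorem nine_sq_le_cap' {x y z : ℝ} (hz : 0 ≤ z) (hzy : z ≤ y) (hyx : y ≤ x) (h : 2 * x * z ≤ y ^ 2) :
    9 * (x ^ 2 + y ^ 2 + z ^ 2) ≤ (4 * x + y - z) ^ 2 ∧ 0 ≤ 4 * x + y - z := by
  have hy : 0 ≤ y := hz.trans hzy
  have hx : 0 ≤ x := hy.trans hyx
  have h2 : 2 * z ≤ y := by
    by_contra hc
    push Not at hc
    have : y * y < 2 * x * z := by nlinarith [mul_le_mul_of_nonneg_left hyx hy]
    nlinarith
  refine ⟨?_, by linarith⟩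
  nlinarith [mul_nonneg hx (by linarith : 0 ≤ y - 2 * z), mul_nonneg hy (by linarith : 0 ≤ y - 2 * z),
    mul_nonneg (by linarith : 0 ≤ x - y) (by linarith : 0 ≤ x + y), mul_nonneg hx (by linarith : 0 ≤ x - y)]

/-! ## §2  The sorted core: an explicit model vector per sign pattern -/

/-- **Sorted covering core.**  For reals `p, q, r` with `|q| ≤ |p|`, `|r| ≤ |q|` and `S` one of the two integer models there are integers `a, b, c`
with `![a, b, c] ∈ S` of squared norm `18`, `0 ≤ ap + bq + cr` and `9(p² + q² + r²) ≤ (ap + bq + cr)²`. [this file] -/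
theorem cover_sorted {S : Finset (Fin 3 → ℤ)} (hS : S = fccModelInt ∨ S = hcpModelInt) (p q r : ℝ) (hqp : |q| ≤ |p|) (hrq : |r| ≤ |q|) :
    ∃ a b c : ℤ, (![a, b, c] : Fin 3 → ℤ) ∈ S ∧ a ^ 2 + b ^ 2 + c ^ 2 = 18 ∧
      0 ≤ (a : ℝ) * p + b * q + c * r ∧ 9 * (p ^ 2 + q ^ 2 + r ^ 2) ≤ ((a : ℝ) * p + b * q + c * r) ^ 2 := by
  have hr0 : 0 ≤ |r| := abs_nonneg r
  have hr2 : r ^ 2 = |r| ^ 2 := (sq_abs r).symm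
  -- the generic pair bound `9(p²+q²+r²) ≤ (3|p| + 3|q|)²`
  have pair : 9 * (p ^ 2 + q ^ 2 + r ^ 2) ≤ (3 * |p| + 3 * |q|) ^ 2 := by
    have := nine_sq_le_pair hr0 (hrq.trans hqp) hrq
    rwa [sq_abs, sq_abs, sq_abs] at this
  have pair0 : 0 ≤ 3 * |p| + 3 * |q| := by positivity
  rcases hS with rfl | rfl
  · -- cuboctahedron: `(±3, ±3, 0)`
    rcases le_or_gt 0 p with hp | hp <;> rcases le_or_gt 0 q with hq | hq
    · refine ⟨3, 3, 0, by decide, by norm_num, ?_, ?_⟩ <;> push_cast <;>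
        rw [abs_of_nonneg hp, abs_of_nonneg hq] at * <;> nlinarith
    · refine ⟨3, -3, 0, by decide, by norm_num, ?_, ?_⟩ <;> push_cast <;>
        rw [abs_of_nonneg hp, abs_of_neg hq] at * <;> nlinarith
    · refine ⟨-3, 3, 0, by decide, by norm_num, ?_, ?_⟩ <;> push_cast <;>
        rw [abs_of_neg hp, abs_of_nonneg hq] at * <;> nlinarith
    · refine ⟨-3, -3, 0, by decide, by norm_num, ?_, ?_⟩ <;> push_cast <;>
        rw [abs_of_neg hp, abs_of_neg hq] at * <;> nlinarith
  · -- anticuboctahedron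
    rcases le_or_gt 0 p with hp | hp <;> rcases le_or_gt 0 q with hq | hq
    · -- upper cap `(3, 3, 0)`
      refine ⟨3, 3, 0, by decide, by norm_num, ?_, ?_⟩ <;> push_cast <;>
        rw [abs_of_nonneg hp, abs_of_nonneg hq] at * <;> nlinarith
    · -- basal `(3, -3, 0)`
      refine ⟨3, -3, 0, by decide, by norm_num, ?_, ?_⟩ <;> push_cast <;>
        rw [abs_of_nonneg hp, abs_of_neg hq] at * <;> nlinarith
    · -- basal `(-3, 3, 0)`
      refine ⟨-3, 3, 0, by decide, by norm_num, ?_, ?_⟩ <;> push_cast <;>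
        rw [abs_of_neg hp, abs_of_nonneg hq] at * <;> nlinarith
    · -- both negative: lower cap `(-4, -1, -1)` or basal `(-3, 0, 3)`
      rw [abs_of_neg hp, abs_of_neg hq] at hqp
      rw [abs_of_neg hq] at hrq
      rcases le_or_gt r 0 with hr | hr
      · refine ⟨-4, -1, -1, by decide, by norm_num, ?_, ?_⟩ <;> push_cast
        · linarith
        · have key := nine_sq_le_cap hr0 hrq hqp
          rw [abs_of_nonpos hr] at key
          nlinarith [key]
      · rw [abs_of_pos hr] at hrq
        rcases le_or_gt (q ^ 2) (2 * (-p) * r) with h2 | h2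
        · refine ⟨-3, 0, 3, by decide, by norm_num, ?_, ?_⟩ <;> push_cast
          · linarith
          · have key := nine_sq_le_skew (x := -p) (z := r) (by nlinarith [h2])
            nlinarith [key]
        · obtain ⟨key, key0⟩ := nine_sq_le_cap' (x := -p) (y := -q) (z := r) hr.le hrq hqp (by nlinarith [h2])
          refine ⟨-4, -1, -1, by decide, by norm_num, ?_, ?_⟩ <;> push_cast
          · linarith
          · nlinarith [key]

/-! ## §3  Coordinate permutations and the unsorted statement -/

/-- Both integer models are invariant under the five non-trivial coordinate permutations. [this file] -/
theorem model_perm {S : Finset (Fin 3 → ℤ)} (hS : S = fccModelInt ∨ S = hcpModelInt) {a b c : ℤ} (h : (![a, b, c] : Fin 3 → ℤ) ∈ S) :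
    (![b, a, c] : Fin 3 → ℤ) ∈ S ∧ (![a, c, b] : Fin 3 → ℤ) ∈ S ∧ (![c, b, a] : Fin 3 → ℤ) ∈ S ∧
      (![b, c, a] : Fin 3 → ℤ) ∈ S ∧ (![c, a, b] : Fin 3 → ℤ) ∈ S := by
  have e : ∀ W : Fin 3 → ℤ, W = ![W 0, W 1, W 2] := fun W => by ext i; fin_cases i <;> rfl
  rcases hS with rfl | rfl
  · have key : ∀ W ∈ fccModelInt, (![W 1, W 0, W 2] : Fin 3 → ℤ) ∈ fccModelInt ∧ (![W 0, W 2, W 1] : Fin 3 → ℤ) ∈ fccModelInt ∧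
        (![W 2, W 1, W 0] : Fin 3 → ℤ) ∈ fccModelInt ∧ (![W 1, W 2, W 0] : Fin 3 → ℤ) ∈ fccModelInt ∧
        (![W 2, W 0, W 1] : Fin 3 → ℤ) ∈ fccModelInt := by decide
    simpa using key _ h
  · have key : ∀ W ∈ hcpModelInt, (![W 1, W 0, W 2] : Fin 3 → ℤ) ∈ hcpModelInt ∧ (![W 0, W 2, W 1] : Fin 3 → ℤ) ∈ hcpModelInt ∧
        (![W 2, W 1, W 0] : Fin 3 → ℤ) ∈ hcpModelInt ∧ (![W 1, W 2, W 0] : Fin 3 → ℤ) ∈ hcpModelInt ∧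
        (![W 2, W 0, W 1] : Fin 3 → ℤ) ∈ hcpModelInt := by decide
    simpa using key _ h

/-- **Unsorted covering core**: for every `u₀, u₁, u₂` a model vector `W ∈ S` of squared norm `18` with `0 ≤ Σ Wᵢuᵢ` and `9·Σuᵢ² ≤ (Σ Wᵢuᵢ)²`. [this file] -/
theorem cover_coords {S : Finset (Fin 3 → ℤ)} (hS : S = fccModelInt ∨ S = hcpModelInt) (u₀ u₁ u₂ : ℝ) :
    ∃ W ∈ S, sqNormInt W = 18 ∧ 0 ≤ (W 0 : ℝ) * u₀ + W 1 * u₁ + W 2 * u₂ ∧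
      9 * (u₀ ^ 2 + u₁ ^ 2 + u₂ ^ 2) ≤ ((W 0 : ℝ) * u₀ + W 1 * u₁ + W 2 * u₂) ^ 2 := by
  -- six orderings of `|u₀|, |u₁|, |u₂|`
  rcases le_total |u₁| |u₀| with h10 | h01 <;> rcases le_total |u₂| |u₁| with h21 | h12 <;>
    rcases le_total |u₂| |u₀| with h20 | h02
  · -- |u₂| ≤ |u₁| ≤ |u₀|
    obtain ⟨a, b, c, hm, hn, h0, h9⟩ := cover_sorted hS u₀ u₁ u₂ h10 h21
    exact ⟨![a, b, c], hm, by simp [sqNormInt]; exact_mod_cast hn, by simpa using h0, by simpa using h9⟩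
  · -- impossible branch combination (|u₂| ≤ |u₁| ≤ |u₀| and |u₀| ≤ |u₂|): still fine, reuse
    obtain ⟨a, b, c, hm, hn, h0, h9⟩ := cover_sorted hS u₀ u₁ u₂ h10 h21
    exact ⟨![a, b, c], hm, by simp [sqNormInt]; exact_mod_cast hn, by simpa using h0, by simpa using h9⟩
  · -- |u₁| ≤ |u₂| ≤ |u₀| : sort (u₀, u₂, u₁)
    obtain ⟨a, b, c, hm, hn, h0, h9⟩ := cover_sorted hS u₀ u₂ u₁ h20 h12
    refine ⟨![a, c, b], (model_perm hS hm).2.1, by simp [sqNormInt]; linarith [hn], ?_, ?_⟩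
    · simpa [add_comm, add_assoc, add_left_comm] using h0
    · have := h9; simp at this ⊢; nlinarith [this]
  · -- |u₁| ≤ |u₀| ≤ |u₂| : sort (u₂, u₀, u₁)
    obtain ⟨a, b, c, hm, hn, h0, h9⟩ := cover_sorted hS u₂ u₀ u₁ h02 h10
    refine ⟨![b, c, a], (model_perm hS hm).2.2.2.1, by simp [sqNormInt]; linarith [hn], ?_, ?_⟩
    · simp; linarith
    · have := h9; simp at this ⊢; nlinarith [this]
  · -- |u₀| ≤ |u₁|, |u₂| ≤ |u₁|, |u₂| ≤ |u₀| : sort (u₁, u₀, u₂)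
    obtain ⟨a, b, c, hm, hn, h0, h9⟩ := cover_sorted hS u₁ u₀ u₂ h01 h20
    refine ⟨![b, a, c], (model_perm hS hm).1, by simp [sqNormInt]; linarith [hn], ?_, ?_⟩
    · simp; linarith
    · have := h9; simp at this ⊢; nlinarith [this]
  · -- |u₀| ≤ |u₁|, |u₂| ≤ |u₁|, |u₀| ≤ |u₂| : sort (u₁, u₂, u₀)
    obtain ⟨a, b, c, hm, hn, h0, h9⟩ := cover_sorted hS u₁ u₂ u₀ h21 h02
    refine ⟨![c, a, b], (model_perm hS hm).2.2.2.2, by simp [sqNormInt]; linarith [hn], ?_, ?_⟩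
    · simp; linarith
    · have := h9; simp at this ⊢; nlinarith [this]
  · -- |u₀| ≤ |u₁| ≤ |u₂| … with |u₂| ≤ |u₀|: degenerate, sort (u₂, u₁, u₀)
    obtain ⟨a, b, c, hm, hn, h0, h9⟩ := cover_sorted hS u₂ u₁ u₀ h12 h01
    refine ⟨![c, b, a], (model_perm hS hm).2.2.1, by simp [sqNormInt]; linarith [hn], ?_, ?_⟩
    · simp; linarith
    · have := h9; simp at this ⊢; nlinarith [this]
  · -- |u₀| ≤ |u₁| ≤ |u₂| : sort (u₂, u₁, u₀)
    obtain ⟨a, b, c, hm, hn, h0, h9⟩ := cover_sorted hS u₂ u₁ u₀ h12 h01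
    refine ⟨![c, b, a], (model_perm hS hm).2.2.1, by simp [sqNormInt]; linarith [hn], ?_, ?_⟩
    · simp; linarith
    · have := h9; simp at this ⊢; nlinarith [this]

/-! ## §4  The pattern form -/

/-- `⟪W/√18, u⟫ = (Σ Wᵢ uᵢ)/√18`. [this file] -/
theorem inner_modelVec (W : Fin 3 → ℤ) (u : EuclideanSpace ℝ (Fin 3)) :
    inner ℝ ((Real.sqrt 18)⁻¹ • intVec W) u = (Real.sqrt 18)⁻¹ * ((W 0 : ℝ) * u 0 + (W 1 : ℝ) * u 1 + (W 2 : ℝ) * u 2) := by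
  rw [real_inner_smul_left]
  congr 1
  simp [intVec, PiLp.inner_apply, Fin.sum_univ_three, mul_comm]

/-- `‖u‖² = u₀² + u₁² + u₂²`. [this file] -/
private theorem norm_sq_coords (u : EuclideanSpace ℝ (Fin 3)) : ‖u‖ ^ 2 = u 0 ^ 2 + u 1 ^ 2 + u 2 ^ 2 := by
  rw [EuclideanSpace.norm_sq_eq, Fin.sum_univ_three]
  simp [Real.norm_eq_abs, sq_abs]

/-- The two patterns as images of the integer models at scale `1/√18` (cast-normalised). [this file] -/
theorem pattern_eq_image {P : Finset (EuclideanSpace ℝ (Fin 3))} (hP : P = fccTwoShellPattern ∨ P = hcpTwoShellPattern) :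
    ∃ S : Finset (Fin 3 → ℤ), (S = fccModelInt ∨ S = hcpModelInt) ∧ P = S.image (fun v => (Real.sqrt 18)⁻¹ • intVec v) := by
  have key : ∀ {S : Finset (Fin 3 → ℤ)}, P = S.image (fun v => (Real.sqrt (18 : ℕ))⁻¹ • intVec v) →
      P = S.image (fun v => (Real.sqrt 18)⁻¹ • intVec v) := by
    intro S h; rw [h]; simp only [Nat.cast_ofNat]
  rcases hP with rfl | rfl
  · exact ⟨fccModelInt, Or.inl rfl, key fccTwoShellPattern_eq_image⟩
  · exact ⟨hcpModelInt, Or.inr rfl, key hcpTwoShellPattern_eq_image⟩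

/-- ★ **COVERING CONSTANT `1/√2`.**  For a two-shell pattern `P ∈ {fcc, hcp}` and every vector `u` there is a FIRST-SHELL point `w ∈ P` (`‖w‖ = 1`) with
`‖u‖ ≤ √2·⟪w, u⟫`, i.e. within `45°` of `u`.  (Sharp for both patterns.)  The input of the descent step of chains-exist (memo §5 (i)). [this file] -/
theorem exists_firstShell_inner_ge {P : Finset (EuclideanSpace ℝ (Fin 3))} (hP : P = fccTwoShellPattern ∨ P = hcpTwoShellPattern)
    (u : EuclideanSpace ℝ (Fin 3)) : ∃ w ∈ P, ‖w‖ = 1 ∧ ‖u‖ ≤ Real.sqrt 2 * inner ℝ w u := by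
  obtain ⟨S, hS, hPS⟩ := pattern_eq_image hP
  obtain ⟨W, hW, h18, h0, h9⟩ := cover_coords hS (u 0) (u 1) (u 2)
  refine ⟨(Real.sqrt 18)⁻¹ • intVec W, by rw [hPS]; exact Finset.mem_image_of_mem _ hW, norm_eq_one_of_sqNormInt h18, ?_⟩
  rw [inner_modelVec]
  set L := (W 0 : ℝ) * u 0 + (W 1 : ℝ) * u 1 + (W 2 : ℝ) * u 2 with hL
  have h18' : Real.sqrt 18 = 3 * Real.sqrt 2 := by
    rw [show (18 : ℝ) = 3 ^ 2 * 2 by norm_num, Real.sqrt_mul (by norm_num), Real.sqrt_sq (by norm_num)]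
  have hs2 : 0 < Real.sqrt 2 := Real.sqrt_pos.2 (by norm_num)
  have e : Real.sqrt 2 * ((Real.sqrt 18)⁻¹ * L) = L / 3 := by
    rw [h18']; field_simp
  rw [e]
  have hu : ‖u‖ ^ 2 ≤ (L / 3) ^ 2 := by rw [norm_sq_coords]; nlinarith [h9]
  nlinarith [hu, norm_nonneg u, h0]

/-! ## §5  The descent step of chains-exist -/

/-- From `‖u‖ ≤ √2·t`: `0 ≤ t` and `7‖u‖ ≤ 10 t` (`7/5 < √2`). [this file] -/
theorem seven_norm_le {u : EuclideanSpace ℝ (Fin 3)} {t : ℝ} (h : ‖u‖ ≤ Real.sqrt 2 * t) : 0 ≤ t ∧ 7 * ‖u‖ ≤ 10 * t := by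
  have hs : 0 < Real.sqrt 2 := Real.sqrt_pos.2 (by norm_num)
  have hs2 : Real.sqrt 2 ^ 2 = 2 := Real.sq_sqrt (by norm_num)
  have ht : 0 ≤ t := by
    by_contra hc
    push Not at hc
    have : Real.sqrt 2 * t < 0 := mul_neg_of_pos_of_neg hs hc
    linarith [norm_nonneg u]
  refine ⟨ht, ?_⟩
  have hu := norm_nonneg u
  have h2 : ‖u‖ ^ 2 ≤ 2 * t ^ 2 := by nlinarith [mul_le_mul h h hu (by positivity)]
  nlinarith [h2, ht, hu]

/-- ★ **DESCENT STEP.**  At a framed, registered site `m` (frame `A` within `1/1000` of an isometry on the two-shell pattern `P`, registration `f` at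
tolerance `10⁻⁴·nn_m`) and for every target `p` at distance `d ≥ 2·nn_m` from `y m`, some FIRST-SHELL pattern point `v` registers to a SITE `f v = y k` that is
closer to the target by `0.45·nn_m`: `dist (f v) p ≤ d − (9/20)·nn_m`.  (Covering constant `1/√2` of §4; iterating it from the deep site produces the
registered first-shell chains of memo §5 (i), `≤ 8` steps down to distance `2·nn` inside the `r₁ = 4–5` core.) [this file] -/
theorem descent_step {y : Fin N → EuclideanSpace ℝ (Fin 3)} {m : Fin N} {A : EuclideanSpace ℝ (Fin 3) →ₗ[ℝ] EuclideanSpace ℝ (Fin 3)}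
    {Q : EuclideanSpace ℝ (Fin 3) →ₗᵢ[ℝ] EuclideanSpace ℝ (Fin 3)} {P : Finset (EuclideanSpace ℝ (Fin 3))}
    {f : EuclideanSpace ℝ (Fin 3) → EuclideanSpace ℝ (Fin 3)} (hP : P = fccTwoShellPattern ∨ P = hcpTwoShellPattern)
    (hA : ∀ v ∈ P, ‖A v - Q v‖ ≤ 1 / 1000)
    (hf : ∀ v ∈ P, f v ∈ Set.range y ∧ dist (f v) (y m + nearestDist y m • A v) ≤ 1 / 10 ^ 4 * nearestDist y m)
    (p : EuclideanSpace ℝ (Fin 3)) (hd : 2 * nearestDist y m ≤ dist (y m) p) :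
    ∃ v ∈ P, ‖v‖ = 1 ∧ (∃ k, y k = f v) ∧ dist (f v) p ≤ dist (y m) p - 9 / 20 * nearestDist y m := by
  -- the direction `u` with `Q u = p - y m`
  have hQs : Function.Surjective Q.toLinearMap :=
    LinearMap.injective_iff_surjective.1 (by rw [LinearIsometry.coe_toLinearMap]; exact Q.injective)
  obtain ⟨u, hu⟩ := hQs (p - y m)
  rw [LinearIsometry.coe_toLinearMap] at hu
  obtain ⟨w, hw, hw1, hcov⟩ := exists_firstShell_inner_ge hP u
  obtain ⟨k, hk⟩ := (hf w hw).1
  refine ⟨w, hw, hw1, ⟨k, hk⟩, ?_⟩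
  -- abbreviations
  set s := nearestDist y m with hs_def
  set d := dist (y m) p with hd_def
  have hs : 0 ≤ s := nearestDist_nonneg y m
  have hdn : ‖p - y m‖ = d := by rw [hd_def, dist_comm, dist_eq_norm]
  have hun : ‖u‖ = d := by rw [← hdn, ← hu]; exact (Q.norm_map u).symm
  obtain ⟨ht, h7⟩ := seven_norm_le hcov
  rw [hun] at h7
  -- the inner products
  have ht' : inner ℝ (Q w) (p - y m) = inner ℝ w u := by rw [← hu]; exact Q.inner_map_map w u
  have he : ‖A w - Q w‖ ≤ 1 / 1000 := hA w hw
  have hie : -(1 / 1000 * d) ≤ inner ℝ (A w - Q w) (p - y m) := by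
    have h1 := abs_real_inner_le_norm (A w - Q w) (p - y m)
    rw [hdn] at h1
    have h2 : ‖A w - Q w‖ * d ≤ 1 / 1000 * d := mul_le_mul_of_nonneg_right he (by rw [hd_def]; exact dist_nonneg)
    have h3 := neg_abs_le (inner ℝ (A w - Q w) (p - y m))
    linarith
  have hsplit : inner ℝ (A w) (p - y m) = inner ℝ (A w - Q w) (p - y m) + inner ℝ (Q w) (p - y m) := by
    rw [← inner_add_left, sub_add_cancel]
  have hna : ‖A w‖ ≤ 1 + 1 / 1000 := by
    have e : A w = Q w + (A w - Q w) := by abel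
    rw [e]
    refine (norm_add_le _ _).trans ?_
    rw [Q.norm_map, hw1]
    linarith
  -- the model point `z = y m + s • A w`
  have hz : ‖(y m + s • A w) - p‖ ^ 2 = s ^ 2 * ‖A w‖ ^ 2 - 2 * s * inner ℝ (A w) (p - y m) + d ^ 2 := by
    have e : (y m + s • A w) - p = s • A w - (p - y m) := by abel
    rw [e, norm_sub_sq_real, real_inner_smul_left, norm_smul, Real.norm_eq_abs, abs_of_nonneg hs, hdn]
    ring
  have hzle : ‖(y m + s • A w) - p‖ ^ 2 ≤ (d - 4501 / 10 ^ 4 * s) ^ 2 := by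
    rw [hz, hsplit, ht']
    have h1 : s ^ 2 * ‖A w‖ ^ 2 ≤ s ^ 2 * (1 + 1 / 1000) ^ 2 :=
      mul_le_mul_of_nonneg_left (pow_le_pow_left₀ (norm_nonneg _) hna 2) (sq_nonneg s)
    have h2 : -(2 * s * inner ℝ (A w - Q w) (p - y m)) ≤ 2 * s * (1 / 1000 * d) := by nlinarith [hie, hs]
    have h3 : -(2 * s * inner ℝ w u) ≤ -(2 * s * (7 / 10 * d)) := by nlinarith [h7, hs]
    nlinarith [h1, h2, h3, hd, hs]
  have hβ : 0 ≤ d - 4501 / 10 ^ 4 * s := by linarith [hd, hs]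
  have hzp : dist (y m + s • A w) p ≤ d - 4501 / 10 ^ 4 * s := by
    rw [dist_eq_norm]
    exact (pow_le_pow_iff_left₀ (norm_nonneg _) hβ two_ne_zero).1 hzle
  have hreg : dist (f w) (y m + s • A w) ≤ 1 / 10 ^ 4 * s := (hf w hw).2
  calc dist (f w) p ≤ dist (f w) (y m + s • A w) + dist (y m + s • A w) p := dist_triangle _ _ _
    _ ≤ 1 / 10 ^ 4 * s + (d - 4501 / 10 ^ 4 * s) := add_le_add hreg hzp
    _ = d - 9 / 20 * s := by ring

end Summit.AtomisticToContinuum.Crystallization.Theorems.OverbindingBudgetAffineCompressedCutReach
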